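import Literature.AlgebraicGeometry.Hu2025.Statements.S07GammaSchemes.R109aGamma
import Literature.AlgebraicGeometry.Hu2025.Proofs.S07GammaSchemes.ChartReadings
import Mathlib.RingTheory.Ideal.Quotient.Operations
import Mathlib.Algebra.MvPolynomial.CommRing
import Mathlib.Algebra.Ring.Equiv
import Mathlib.Tactic.FinCases
import Mathlib.Tactic.Ring
import HarnessLib

/-!
# Hu 2025 (arXiv:2507.21400v1) §7.2, Lemma 7.3 — the induction base `k = 0` of the printed proof (C57L144–L153:
# «𝔙 = 𝐔 … Z_{𝔉[0],Γ} = Z†_{𝔉[0],Γ} := Z_Γ … Γ̃⁰_𝔙 = Γ. Then, the statement holds trivially.») on the toy chart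
# `n = 5`, `m = (123)`, `Γ = {x₁₂₄, x₁₃₄}` — KERNEL SUPPORT over the typed carriers of row 109 (`R109aGamma.lean`,
# `R109bFTransforms.lean`) and the reading lemmas of `ChartReadings.lean`

**Honest framing (D-0012/D-0089).** Kernel facts about TYPED decls on ONE toy instance, taking no side on the manuscript
[Hu2025] (arXiv:2507.21400v1, lit key `paper:arxiv-2507.21400`, UNREFEREED, under adjudication at rung M-Hu-min of the
campaign `res-hironaka`); nothing of [Hu2025] is asserted; AI typing/proving is weaker than expert review. Provenance:
res-type-016 (typer of record of row 109). On the chart `𝐔 = (p_{123} ≠ 0)` of `n = 5` with its nine variables and the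
THREE de-homogenised `(123)`-primary Plücker relations AS PRINTED (C18L21–L25 with `u = 4`, `v = 5`; p.39–40):
`F̄₁ = x₁₄₅ − x₁₂₄x₁₃₅ + x₁₃₄x₁₂₅`, `F̄₂ = x₂₄₅ − x₁₂₄x₂₃₅ + x₂₃₄x₁₂₅`, `F̄₃ = x₃₄₅ − x₁₃₄x₂₃₅ + x₂₃₄x₁₃₅`, and
`Γ = {x₁₂₄, x₁₃₄}`:
* `zGammaIntegral_toy` — `Z_Γ` IS integral (`ZGammaIntegral 𝔉 Γ`; `𝔽[x]/I_{℘,Γ} ≅ ℚ[x₁₂₅, x₁₃₅, x₂₃₄, x₂₃₅]`): a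
  NON-VACUITY witness for the `hInt` slot of every row-109 decl;
* `X_mem_iff` — `x₁₄₅ ∈ I_{℘,Γ}` although `x₁₄₅ ∉ Γ`; precisely `{y | x_y ∈ I_{℘,Γ}} = {x₁₂₄, x₁₃₄, x₁₄₅}` (= `gamma0Sat`);
* with the `k = 0` data of C57L144–L151 (`D0`: `Z = Z† := Z_Γ` on `𝔙 = 𝐔`, `Γ̃⁰_𝐔 := Γ`, `Γ̃¹ = ∅`; relation family = the
  `F̄_{𝔙,j}`, `0 < j ≤ Υ`, i.e. all of `𝔉`): the bullets, item (1) (`DefinedBy`), item (2) (the identity is birational)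
  and item (3) hold, but the MAXIMALITY CLAUSE FAILS under both claim readings (`not_gamma0Maximal_D0`,
  `not_lem7_3_1max_D0` — with the TRUE hypothesis `hInt := ZGammaIntegral 𝔉 Γ`): «the statement holds trivially»
  (C57L153) does not cover the clause C57L127–L129 read as a claim about `Γ̃⁰_𝐔 := Γ`;
* with `Γ̃⁰_𝐔 := {x₁₂₄, x₁₃₄, x₁₄₅}` (`D1`, what the DEFINITION reading `gamma0Sat` produces) item (1) and BOTH
  maximality readings hold (`lem7_3_1max_D1`).
Which reading the author intends, and what this means for (7.6)/(7.11)/(7.13) at `k ≥ 1`, is for the M-Hu adjudication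
(J3 read-list: `Lem7_4_1max`), not for this file.

Variables (index `Fin 9`): `0 ↦ x₁₂₄, 1 ↦ x₁₂₅, 2 ↦ x₁₃₄, 3 ↦ x₁₃₅, 4 ↦ x₁₄₅, 5 ↦ x₂₃₄, 6 ↦ x₂₃₅, 7 ↦ x₂₄₅, 8 ↦ x₃₄₅`.

## References
* [Hu2025] Y. Hu, arXiv:2507.21400v1 (2025), Def. 3.4 display C18L20–L32 (p.39–40); Def. 7.1 C57L9–L24 (p.128); Lem. 7.3
  C57L79–L153 (p.129–130) — cited as the loci of the typed definitions only (unrefereed manuscript under adjudication).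
-/

noncomputable section

open scoped nonZeroDivisors

namespace Literature.AlgebraicGeometry.Hu2025.Statements.S07GammaSchemes

/-! ## 2. The toy chart `n = 5`, `m = (123)`, `Γ = {x₁₂₄, x₁₃₄}` -/

namespace Lem73BaseToy

open MvPolynomial GammaTransformChart

/-- Coordinate ring of the chart `𝐔 ⊂ ℙ(∧³E)`, `n = 5`: nine variables (see the module docstring for the indexing). [cite: Hu2025, Def. 7.1 / Lem. 7.3 proof at k = 0, chunk p0057 l.9–24, l.144–153; p.128–130 (unrefereed manuscript under adjudication — kernel support on a toy instance of the typed carriers, nothing of the manuscript asserted)] -/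
abbrev R : Type := MvPolynomial (Fin 9) ℚ

/-- `F̄_{(123),145} = x₁₄₅ − x₁₂₄x₁₃₅ + x₁₃₄x₁₂₅` (C18L21 with `u = 4`, `v = 5`). [cite: Hu2025, Def. 7.1 / Lem. 7.3 proof at k = 0, chunk p0057 l.9–24, l.144–153; p.128–130 (unrefereed manuscript under adjudication — kernel support on a toy instance of the typed carriers, nothing of the manuscript asserted)] -/
def F1 : R := X 4 - X 0 * X 3 + X 2 * X 1

/-- `F̄_{(123),245} = x₂₄₅ − x₁₂₄x₂₃₅ + x₂₃₄x₁₂₅` (C18L23 with `u = 4`, `v = 5`). [cite: Hu2025, Def. 7.1 / Lem. 7.3 proof at k = 0, chunk p0057 l.9–24, l.144–153; p.128–130 (unrefereed manuscript under adjudication — kernel support on a toy instance of the typed carriers, nothing of the manuscript asserted)] -/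
def F2 : R := X 7 - X 0 * X 6 + X 5 * X 1

/-- `F̄_{(123),345} = x₃₄₅ − x₁₃₄x₂₃₅ + x₂₃₄x₁₃₅` (C18L25 with `u = 4`, `v = 5`). [cite: Hu2025, Def. 7.1 / Lem. 7.3 proof at k = 0, chunk p0057 l.9–24, l.144–153; p.128–130 (unrefereed manuscript under adjudication — kernel support on a toy instance of the typed carriers, nothing of the manuscript asserted)] -/
def F3 : R := X 8 - X 2 * X 6 + X 5 * X 3

/-- The relation family `𝔉 = {F̄₁, F̄₂, F̄₃}` indexed by `Fin 3` (`Υ(5) = 3`). [cite: Hu2025, Def. 7.1 / Lem. 7.3 proof at k = 0, chunk p0057 l.9–24, l.144–153; p.128–130 (unrefereed manuscript under adjudication — kernel support on a toy instance of the typed carriers, nothing of the manuscript asserted)] -/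
def rels (j : Fin 3) : R := if j = 0 then F1 else if j = 1 then F2 else F3

/-- `𝔉` as a set (the parameter of `gammaWpIdeal`). [cite: Hu2025, Def. 7.1 / Lem. 7.3 proof at k = 0, chunk p0057 l.9–24, l.144–153; p.128–130 (unrefereed manuscript under adjudication — kernel support on a toy instance of the typed carriers, nothing of the manuscript asserted)] -/
def 𝔉 : Set R := Set.range rels

/-- `Γ = {x₁₂₄, x₁₃₄}`. [cite: Hu2025, Def. 7.1 / Lem. 7.3 proof at k = 0, chunk p0057 l.9–24, l.144–153; p.128–130 (unrefereed manuscript under adjudication — kernel support on a toy instance of the typed carriers, nothing of the manuscript asserted)] -/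
def Γ : Finset (Fin 9) := {0, 2}

/-- `I_{℘,Γ}` of Def. 7.1 for the toy. [cite: Hu2025, Def. 7.1 / Lem. 7.3 proof at k = 0, chunk p0057 l.9–24, l.144–153; p.128–130 (unrefereed manuscript under adjudication — kernel support on a toy instance of the typed carriers, nothing of the manuscript asserted)] -/
abbrev I : Ideal R := gammaWpIdeal 𝔉 (Γ : Set (Fin 9))

/-- The `k = 0` data of C57L144–L151 on the unique chart `𝔙 = 𝐔`: `Z_{𝔉[0],Γ} = Z†_{𝔉[0],Γ} := Z_Γ`, `Γ̃⁰_𝐔 := Γ`,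
`Γ̃¹_𝐔 = ∅`. [cite: Hu2025, Def. 7.1 / Lem. 7.3 proof at k = 0, chunk p0057 l.9–24, l.144–153; p.128–130 (unrefereed manuscript under adjudication — kernel support on a toy instance of the typed carriers, nothing of the manuscript asserted)] -/
def D0 : GammaTransformChart (Fin 9) R := ⟨I, I, Γ, ∅⟩

/-- The same with `Γ̃⁰_𝐔 := {x₁₂₄, x₁₃₄, x₁₄₅}` (what the DEFINITION reading of the maximality clause produces). [cite: Hu2025, Def. 7.1 / Lem. 7.3 proof at k = 0, chunk p0057 l.9–24, l.144–153; p.128–130 (unrefereed manuscript under adjudication — kernel support on a toy instance of the typed carriers, nothing of the manuscript asserted)] -/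
def D1 : GammaTransformChart (Fin 9) R := ⟨I, I, {0, 2, 4}, ∅⟩

/-- Images of the nine variables in `ℚ[y₀, y₁, y₂, y₃]` realising `R ⧸ I_{℘,Γ} ≅ ℚ[x₁₂₅, x₁₃₅, x₂₃₄, x₂₃₅]`. [cite: Hu2025, Def. 7.1 / Lem. 7.3 proof at k = 0, chunk p0057 l.9–24, l.144–153; p.128–130 (unrefereed manuscript under adjudication — kernel support on a toy instance of the typed carriers, nothing of the manuscript asserted)] -/
def g (i : Fin 9) : MvPolynomial (Fin 4) ℚ :=
  if i = 1 then X 0 else if i = 3 then X 1 else if i = 5 then X 2 else if i = 6 then X 3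
  else if i = 7 then -(X 2 * X 0) else if i = 8 then -(X 2 * X 1) else 0

/-- The section: `y₀ ↦ x₁₂₅, y₁ ↦ x₁₃₅, y₂ ↦ x₂₃₄, y₃ ↦ x₂₃₅`. [cite: Hu2025, Def. 7.1 / Lem. 7.3 proof at k = 0, chunk p0057 l.9–24, l.144–153; p.128–130 (unrefereed manuscript under adjudication — kernel support on a toy instance of the typed carriers, nothing of the manuscript asserted)] -/
def s (j : Fin 4) : R := if j = 0 then X 1 else if j = 1 then X 3 else if j = 2 then X 5 else X 6

/-- `φ : R → ℚ[y]`, killing `I_{℘,Γ}`. [cite: Hu2025, Def. 7.1 / Lem. 7.3 proof at k = 0, chunk p0057 l.9–24, l.144–153; p.128–130 (unrefereed manuscript under adjudication — kernel support on a toy instance of the typed carriers, nothing of the manuscript asserted)] -/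
def φ : R →ₐ[ℚ] MvPolynomial (Fin 4) ℚ := aeval g

/-- `ψ : ℚ[y] → R`, the section of `φ`. [cite: Hu2025, Def. 7.1 / Lem. 7.3 proof at k = 0, chunk p0057 l.9–24, l.144–153; p.128–130 (unrefereed manuscript under adjudication — kernel support on a toy instance of the typed carriers, nothing of the manuscript asserted)] -/
def ψ : MvPolynomial (Fin 4) ℚ →ₐ[ℚ] R := aeval s

/-- Helper `X0_mem` for the toy computation (see the module docstring). [cite: Hu2025, Def. 7.1 / Lem. 7.3 proof at k = 0, chunk p0057 l.9–24, l.144–153; p.128–130 (unrefereed manuscript under adjudication — kernel support on a toy instance of the typed carriers, nothing of the manuscript asserted)] -/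
theorem X0_mem : (X 0 : R) ∈ I :=
  Ideal.mem_sup_left (Ideal.subset_span ⟨0, by simp [Γ], rfl⟩)

/-- Helper `X2_mem` for the toy computation (see the module docstring). [cite: Hu2025, Def. 7.1 / Lem. 7.3 proof at k = 0, chunk p0057 l.9–24, l.144–153; p.128–130 (unrefereed manuscript under adjudication — kernel support on a toy instance of the typed carriers, nothing of the manuscript asserted)] -/
theorem X2_mem : (X 2 : R) ∈ I :=
  Ideal.mem_sup_left (Ideal.subset_span ⟨2, by simp [Γ], rfl⟩)

/-- Helper `rels_mem` for the toy computation (see the module docstring). [cite: Hu2025, Def. 7.1 / Lem. 7.3 proof at k = 0, chunk p0057 l.9–24, l.144–153; p.128–130 (unrefereed manuscript under adjudication — kernel support on a toy instance of the typed carriers, nothing of the manuscript asserted)] -/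
theorem rels_mem (j : Fin 3) : rels j ∈ I := Ideal.mem_sup_right (Ideal.subset_span ⟨j, rfl⟩)

/-- Helper `F1_mem` for the toy computation (see the module docstring). [cite: Hu2025, Def. 7.1 / Lem. 7.3 proof at k = 0, chunk p0057 l.9–24, l.144–153; p.128–130 (unrefereed manuscript under adjudication — kernel support on a toy instance of the typed carriers, nothing of the manuscript asserted)] -/
theorem F1_mem : F1 ∈ I := by simpa [rels] using rels_mem 0
/-- Helper `F2_mem` for the toy computation (see the module docstring). [cite: Hu2025, Def. 7.1 / Lem. 7.3 proof at k = 0, chunk p0057 l.9–24, l.144–153; p.128–130 (unrefereed manuscript under adjudication — kernel support on a toy instance of the typed carriers, nothing of the manuscript asserted)] -/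
theorem F2_mem : F2 ∈ I := by simpa [rels] using rels_mem 1
/-- Helper `F3_mem` for the toy computation (see the module docstring). [cite: Hu2025, Def. 7.1 / Lem. 7.3 proof at k = 0, chunk p0057 l.9–24, l.144–153; p.128–130 (unrefereed manuscript under adjudication — kernel support on a toy instance of the typed carriers, nothing of the manuscript asserted)] -/
theorem F3_mem : F3 ∈ I := by simpa [rels] using rels_mem 2

/-- **`x₁₄₅ ∈ I_{℘,Γ}`** although `x₁₄₅ ∉ Γ`: `x₁₄₅ = F̄₁ + x₁₂₄x₁₃₅ − x₁₃₄x₁₂₅`. [cite: Hu2025, Def. 7.1 / Lem. 7.3 proof at k = 0, chunk p0057 l.9–24, l.144–153; p.128–130 (unrefereed manuscript under adjudication — kernel support on a toy instance of the typed carriers, nothing of the manuscript asserted)] -/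
theorem X4_mem : (X 4 : R) ∈ I := by
  have : (X 4 : R) = F1 + X 0 * X 3 - X 2 * X 1 := by simp only [F1]; ring
  rw [this]
  exact I.sub_mem (I.add_mem F1_mem (I.mul_mem_right _ X0_mem)) (I.mul_mem_right _ X2_mem)

/-- Helper `X7_add_mem` for the toy computation (see the module docstring). [cite: Hu2025, Def. 7.1 / Lem. 7.3 proof at k = 0, chunk p0057 l.9–24, l.144–153; p.128–130 (unrefereed manuscript under adjudication — kernel support on a toy instance of the typed carriers, nothing of the manuscript asserted)] -/
theorem X7_add_mem : (X 7 + X 5 * X 1 : R) ∈ I := by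
  have : (X 7 + X 5 * X 1 : R) = F2 + X 0 * X 6 := by simp only [F2]; ring
  rw [this]
  exact I.add_mem F2_mem (I.mul_mem_right _ X0_mem)

/-- Helper `X8_add_mem` for the toy computation (see the module docstring). [cite: Hu2025, Def. 7.1 / Lem. 7.3 proof at k = 0, chunk p0057 l.9–24, l.144–153; p.128–130 (unrefereed manuscript under adjudication — kernel support on a toy instance of the typed carriers, nothing of the manuscript asserted)] -/
theorem X8_add_mem : (X 8 + X 5 * X 3 : R) ∈ I := by
  have : (X 8 + X 5 * X 3 : R) = F3 + X 2 * X 6 := by simp only [F3]; ring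
  rw [this]
  exact I.add_mem F3_mem (I.mul_mem_right _ X2_mem)

/-- Every variable is congruent to the section of its image modulo `I_{℘,Γ}`. [cite: Hu2025, Def. 7.1 / Lem. 7.3 proof at k = 0, chunk p0057 l.9–24, l.144–153; p.128–130 (unrefereed manuscript under adjudication — kernel support on a toy instance of the typed carriers, nothing of the manuscript asserted)] -/
theorem X_sub_section_mem (i : Fin 9) : (X i : R) - ψ (φ (X i)) ∈ I := by
  fin_cases i <;>
    simp [φ, ψ, g, s, X0_mem, X2_mem, X4_mem, sub_eq_add_neg, X7_add_mem, X8_add_mem]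

/-- Hence every polynomial is congruent to the section of its image modulo `I_{℘,Γ}`. [cite: Hu2025, Def. 7.1 / Lem. 7.3 proof at k = 0, chunk p0057 l.9–24, l.144–153; p.128–130 (unrefereed manuscript under adjudication — kernel support on a toy instance of the typed carriers, nothing of the manuscript asserted)] -/
theorem sub_section_mem (f : R) : f - ψ (φ f) ∈ I := by
  have key : (Ideal.Quotient.mkₐ ℚ I).comp (ψ.comp φ) = Ideal.Quotient.mkₐ ℚ I := by
    apply MvPolynomial.algHom_ext
    intro i
    simp only [AlgHom.comp_apply, Ideal.Quotient.mkₐ_eq_mk]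
    rw [Ideal.Quotient.eq]
    simpa using I.neg_mem (X_sub_section_mem i)
  have := congrArg (fun h : R →ₐ[ℚ] R ⧸ I => h f) key
  simp only [AlgHom.comp_apply, Ideal.Quotient.mkₐ_eq_mk] at this
  rw [Ideal.Quotient.eq] at this
  simpa using I.neg_mem this

/-- Helper `φ_rels` for the toy computation (see the module docstring). [cite: Hu2025, Def. 7.1 / Lem. 7.3 proof at k = 0, chunk p0057 l.9–24, l.144–153; p.128–130 (unrefereed manuscript under adjudication — kernel support on a toy instance of the typed carriers, nothing of the manuscript asserted)] -/
theorem φ_rels (j : Fin 3) : φ (rels j) = 0 := by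
  fin_cases j <;> simp [rels, F1, F2, F3, φ, g]

/-- `ker φ = I_{℘,Γ}`. [cite: Hu2025, Def. 7.1 / Lem. 7.3 proof at k = 0, chunk p0057 l.9–24, l.144–153; p.128–130 (unrefereed manuscript under adjudication — kernel support on a toy instance of the typed carriers, nothing of the manuscript asserted)] -/
theorem ker_eq : RingHom.ker (φ : R →+* MvPolynomial (Fin 4) ℚ) = I := by
  apply le_antisymm
  · intro f hf
    have h0 : φ f = 0 := hf
    simpa [h0] using sub_section_mem f
  · apply sup_le
    · rw [gammaIdeal, Ideal.span_le]
      rintro _ ⟨y, hy, rfl⟩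
      have hy' : y = 0 ∨ y = 2 := by simpa [Γ] using hy
      rcases hy' with rfl | rfl <;> simp [RingHom.mem_ker, φ, g]
    · rw [Ideal.span_le]
      rintro _ ⟨j, rfl⟩
      exact φ_rels j

/-- Helper `φ_surjective` for the toy computation (see the module docstring). [cite: Hu2025, Def. 7.1 / Lem. 7.3 proof at k = 0, chunk p0057 l.9–24, l.144–153; p.128–130 (unrefereed manuscript under adjudication — kernel support on a toy instance of the typed carriers, nothing of the manuscript asserted)] -/
theorem φ_surjective : Function.Surjective φ := by
  have key : φ.comp ψ = AlgHom.id ℚ _ := by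
    apply MvPolynomial.algHom_ext
    intro j
    fin_cases j <;> simp [φ, ψ, g, s]
  intro q
  exact ⟨ψ q, by simpa using congrArg (fun h : MvPolynomial (Fin 4) ℚ →ₐ[ℚ] MvPolynomial (Fin 4) ℚ => h q) key⟩

/-- **`Z_Γ` is integral for the toy** (`𝔽[x]/I_{℘,Γ} ≅ ℚ[y₀,…,y₃]`): the J1 hypothesis «Assume that Z_Γ is integral» in
the TYPED form `ZGammaIntegral` is satisfied here — a non-vacuity witness for the `hInt` slot.
[cite: Hu2025, Lem. 7.3 C57L80 «Assume that Z_Γ is integral», p.129 (unrefereed manuscript under adjudication — kernel support over the typed carriers, nothing asserted)] -/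
theorem zGammaIntegral_toy : ZGammaIntegral 𝔉 (Γ : Set (Fin 9)) := by
  unfold ZGammaIntegral GammaSchemeRing
  let e : (R ⧸ I) ≃+* MvPolynomial (Fin 4) ℚ :=
    (Ideal.quotEquivOfEq ker_eq.symm).trans (RingHom.quotientKerEquivOfSurjective φ_surjective)
  exact MulEquiv.isDomain (MvPolynomial (Fin 4) ℚ) e.toMulEquiv

/-- Helper `I_ne_top` for the toy computation (see the module docstring). [cite: Hu2025, Def. 7.1 / Lem. 7.3 proof at k = 0, chunk p0057 l.9–24, l.144–153; p.128–130 (unrefereed manuscript under adjudication — kernel support on a toy instance of the typed carriers, nothing of the manuscript asserted)] -/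
theorem I_ne_top : I ≠ ⊤ := by
  rw [← ker_eq]
  intro h
  have : (1 : R) ∈ RingHom.ker (φ : R →+* MvPolynomial (Fin 4) ℚ) := h ▸ Submodule.mem_top
  simp [RingHom.mem_ker] at this

/-- **Which variables vanish on `Z_Γ` (scheme-theoretically):** `x_y ∈ I_{℘,Γ} ⟺ y ∈ {x₁₂₄, x₁₃₄, x₁₄₅}`. [cite: Hu2025, Def. 7.1 / Lem. 7.3 proof at k = 0, chunk p0057 l.9–24, l.144–153; p.128–130 (unrefereed manuscript under adjudication — kernel support on a toy instance of the typed carriers, nothing of the manuscript asserted)] -/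
theorem X_mem_iff (y : Fin 9) : (X y : R) ∈ I ↔ y ∈ ({0, 2, 4} : Finset (Fin 9)) := by
  constructor
  · intro hy
    have hk : (X y : R) ∈ RingHom.ker (φ : R →+* MvPolynomial (Fin 4) ℚ) := by rw [ker_eq]; exact hy
    rw [RingHom.mem_ker] at hk
    fin_cases y <;> simp_all [φ, g, X_ne_zero]
  · intro hy
    simp only [Finset.mem_insert, Finset.mem_singleton] at hy
    rcases hy with rfl | rfl | rfl
    · exact X0_mem
    · exact X2_mem
    · exact X4_mem

/-! ### The `k = 0` data `D0` (Γ̃⁰_𝐔 := Γ): everything but the maximality clause -/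

/-- Item (1) holds at `k = 0` with `Γ̃⁰_𝐔 := Γ`: `I(Z_Γ) = ⟨x_y (y ∈ Γ), 𝔉⟩` (the families `B`, `L` for `i ∈ [0] = ∅`
are empty; the `F̄_{𝔙,j}`, `0 < j ≤ Υ`, are all of `𝔉`).
[cite: Hu2025, Lem. 7.3 proof C57L144–L153, p.130 (unrefereed manuscript under adjudication — kernel support, nothing asserted)] -/
theorem definedBy_D0 : D0.DefinedBy X X rels := by
  show D0.zIdeal = _
  simp only [D0, Finset.coe_empty, Set.image_empty, Set.union_empty, Ideal.span_union]
  rfl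

/-- `Lem7_3_1` holds for the `k = 0` data (any `hInt`). [cite: Hu2025, Def. 7.1 / Lem. 7.3 proof at k = 0, chunk p0057 l.9–24, l.144–153; p.128–130 (unrefereed manuscript under adjudication — kernel support on a toy instance of the typed carriers, nothing of the manuscript asserted)] -/
theorem lem7_3_1_D0 (hInt : Prop) : Lem7_3_1 hInt X rels D0 := fun _ _ => definedBy_D0

/-- The bullets hold for the `k = 0` data over `𝐔` (structure map `id`, `𝒱_[0] ∩ 𝐔 = Z_∅` with ideal `⟨𝔉⟩`,
C57L29–L31), given «Z_Γ integral» in the typed form. [cite: Hu2025, Def. 7.1 / Lem. 7.3 proof at k = 0, chunk p0057 l.9–24, l.144–153; p.128–130 (unrefereed manuscript under adjudication — kernel support on a toy instance of the typed carriers, nothing of the manuscript asserted)] -/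
theorem lem7_3_bullets_D0 :
    Lem7_3_bullets (ZGammaIntegral 𝔉 (Γ : Set (Fin 9))) (RingHom.id R) I (Ideal.span 𝔉) D0 := by
  intro hInt _
  refine ⟨⟨le_sup_right, by simp [D0, Ideal.map_id]⟩, ?_, rfl⟩
  intro _
  haveI : IsDomain (R ⧸ I) := hInt
  haveI : I.IsPrime := (Ideal.Quotient.isDomain_iff_prime I).mp inferInstance
  show I ∈ Ideal.minimalPrimes I
  rw [Ideal.minimalPrimes_eq_subsingleton_self]
  exact Set.mem_singleton _

/-- Item (2) holds for the `k = 0` data: `Z† = Z_Γ`, the identity is birational (`IsBirationalHom id`). [cite: Hu2025, Def. 7.1 / Lem. 7.3 proof at k = 0, chunk p0057 l.9–24, l.144–153; p.128–130 (unrefereed manuscript under adjudication — kernel support on a toy instance of the typed carriers, nothing of the manuscript asserted)] -/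
theorem lem7_3_2_D0 (hInt : Prop) :
    Lem7_3_2 hInt D0 (RingHom.id (GammaSchemeRing 𝔉 (Γ : Set (Fin 9)))) := by
  intro _ _
  refine ⟨fun a b h => h, fun c => ⟨c, 1, ?_, ?_⟩⟩
  · rw [map_one]
    exact one_mem _
  · rw [map_one, mul_one]
    rfl

/-- Item (3) holds for the `k = 0` data (`Z† = Z`). [cite: Hu2025, Def. 7.1 / Lem. 7.3 proof at k = 0, chunk p0057 l.9–24, l.144–153; p.128–130 (unrefereed manuscript under adjudication — kernel support on a toy instance of the typed carriers, nothing of the manuscript asserted)] -/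
theorem lem7_3_3_D0 (hInt : Prop) : Lem7_3_3 hInt X D0 := fun _ _ _ => Iff.rfl

/-- **The maximality clause FAILS for the `k = 0` data `Γ̃⁰_𝐔 := Γ`** (maximal-element reading): `x₁₄₅ ∈ I(Z_Γ)` but
`x₁₄₅ ∉ Γ`, so `Γ ∪ {x₁₄₅}` also satisfies item (1).
[cite: Hu2025, Lem. 7.3 (1) C57L127–L129 with proof C57L151–L153 «Γ̃⁰_𝔙 = Γ. Then, the statement holds trivially.», p.130 (unrefereed manuscript under adjudication — kernel fact about the typed reading on a toy instance, nothing of the manuscript asserted or denied)] -/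
theorem not_gamma0Maximal_D0 : ¬ D0.Gamma0Maximal X X rels := by
  rw [gamma0Maximal_iff D0 definedBy_D0]
  intro h
  have := h 4 X4_mem
  simp [D0, Γ] at this

/-- The greatest-element reading fails for `D0` too (the readings are equivalent). [cite: Hu2025, Def. 7.1 / Lem. 7.3 proof at k = 0, chunk p0057 l.9–24, l.144–153; p.128–130 (unrefereed manuscript under adjudication — kernel support on a toy instance of the typed carriers, nothing of the manuscript asserted)] -/
theorem not_gamma0Greatest_D0 : ¬ D0.Gamma0Greatest X X rels := by
  rw [← gamma0Maximal_iff_gamma0Greatest]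
  exact not_gamma0Maximal_D0

/-- **`Lem7_3_1max` is false for the `k = 0` data with the TRUE hypothesis `hInt := ZGammaIntegral 𝔉 Γ`** (so the failure
is not an artefact of a vacuous slot).
[cite: Hu2025, Lem. 7.3 (1) C57L127–L129 / C57L153, p.130 (unrefereed manuscript under adjudication — kernel fact about the typed reading on a toy instance, nothing asserted or denied about the manuscript)] -/
theorem not_lem7_3_1max_D0 : ¬ Lem7_3_1max (ZGammaIntegral 𝔉 (Γ : Set (Fin 9))) X rels D0 :=
  fun h => not_gamma0Maximal_D0 (h zGammaIntegral_toy I_ne_top)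

/-- Consequently the typed conjunction `Lem7_3` fails for the `k = 0` data `D0` (only through its maximality conjunct). [cite: Hu2025, Def. 7.1 / Lem. 7.3 proof at k = 0, chunk p0057 l.9–24, l.144–153; p.128–130 (unrefereed manuscript under adjudication — kernel support on a toy instance of the typed carriers, nothing of the manuscript asserted)] -/
theorem not_lem7_3_D0 :
    ¬ Lem7_3 (ZGammaIntegral 𝔉 (Γ : Set (Fin 9))) (RingHom.id R) I (Ideal.span 𝔉) X rels D0
      (RingHom.id (GammaSchemeRing 𝔉 (Γ : Set (Fin 9)))) :=
  fun h => not_lem7_3_1max_D0 h.2.2.1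

/-! ### The data `D1` (Γ̃⁰_𝐔 := {x₁₂₄, x₁₃₄, x₁₄₅}): the definition reading -/

/-- Item (1) also holds at `Γ̃⁰_𝐔 := {x₁₂₄, x₁₃₄, x₁₄₅}`. [cite: Hu2025, Def. 7.1 / Lem. 7.3 proof at k = 0, chunk p0057 l.9–24, l.144–153; p.128–130 (unrefereed manuscript under adjudication — kernel support on a toy instance of the typed carriers, nothing of the manuscript asserted)] -/
theorem definedBy_D1 : D1.DefinedBy X X rels := by
  have h : D0.DefinedByWith X X rels {0, 2, 4} :=
    definedByWith_mono D0 definedBy_D0 (by decide) (fun y hy => (X_mem_iff y).mpr hy)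
  exact h

/-- **With `Γ̃⁰_𝐔 := {y | x_y ∈ I(Z_Γ)} = {x₁₂₄, x₁₃₄, x₁₄₅}` both maximality readings hold.** [cite: Hu2025, Def. 7.1 / Lem. 7.3 proof at k = 0, chunk p0057 l.9–24, l.144–153; p.128–130 (unrefereed manuscript under adjudication — kernel support on a toy instance of the typed carriers, nothing of the manuscript asserted)] -/
theorem gamma0Maximal_D1 : D1.Gamma0Maximal X X rels := by
  rw [gamma0Maximal_iff D1 definedBy_D1]
  intro y hy
  exact (X_mem_iff y).mp hy

/-- Helper `gamma0Greatest_D1` for the toy computation (see the module docstring). [cite: Hu2025, Def. 7.1 / Lem. 7.3 proof at k = 0, chunk p0057 l.9–24, l.144–153; p.128–130 (unrefereed manuscript under adjudication — kernel support on a toy instance of the typed carriers, nothing of the manuscript asserted)] -/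
theorem gamma0Greatest_D1 : D1.Gamma0Greatest X X rels :=
  (gamma0Maximal_iff_gamma0Greatest D1 X X rels).mp gamma0Maximal_D1

/-- `Lem7_3_1max` holds for `D1` (any `hInt`). [cite: Hu2025, Def. 7.1 / Lem. 7.3 proof at k = 0, chunk p0057 l.9–24, l.144–153; p.128–130 (unrefereed manuscript under adjudication — kernel support on a toy instance of the typed carriers, nothing of the manuscript asserted)] -/
theorem lem7_3_1max_D1 (hInt : Prop) : Lem7_3_1max hInt X rels D1 := fun _ _ => gamma0Maximal_D1

/-- The definition-reading set for the toy: `gamma0Sat = {x₁₂₄, x₁₃₄, x₁₄₅}` (for `D0` and `D1` alike — same chart ideal).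
[cite: Hu2025, Lem. 7.3 (1) C57L127–L129 / C57L151, p.130 (unrefereed manuscript under adjudication — kernel support on a toy instance, nothing asserted)] -/
theorem gamma0Sat_D0 : D0.gamma0Sat X = (({0, 2, 4} : Finset (Fin 9)) : Set (Fin 9)) := by
  ext y
  rw [Finset.mem_coe, ← X_mem_iff y]
  rfl

/-- … and `Γ̃⁰_𝐔 = Γ` is NOT what the definition reading gives here: `{x₁₂₄, x₁₃₄, x₁₄₅} ≠ Γ`. [cite: Hu2025, Def. 7.1 / Lem. 7.3 proof at k = 0, chunk p0057 l.9–24, l.144–153; p.128–130 (unrefereed manuscript under adjudication — kernel support on a toy instance of the typed carriers, nothing of the manuscript asserted)] -/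
theorem D1_gamma0_ne_Γ : D1.gamma0 ≠ Γ := by decide

end Lem73BaseToy

end Literature.AlgebraicGeometry.Hu2025.Statements.S07GammaSchemes

end
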